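/-
Copyright (c) 2026 the pub-hodgecm-mathlib formalisation cell (harness21).  Prover seat hodgecm-mathlib-K2E5-p16 (g8): Track B «K2-LIT»,
hLiu418 = stmt-HodgeConjecture-24832; LEAD F0P6-plan (g14) BATCH #53 (2) ∕ #54 (1) «(E4) GK SPHERICAL VALUE n = 2, β = 0», cut (F-GK-4), ED. 1 (hypothesis-first);
ED. 2 (LEAD BATCH #58 (4) ∕ #59 (1); desk K2Liu-p13 (g4) 16:54:06Z): §3, the face AT THE RECORD `χ = toHeckeCharacter L lam⁻¹` in the `c_v(s)` currency, cofinitely;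
ED. 3: §4, the cofinite D10 letter `hGK` DISCHARGED by ★ (F-GK-3) FILE B `K2LiuSiegelCocycleSphericalLocalInt` (K2Liu-p27 (g0)) in the ★ B8-CM frame — unconditional.
-/
import Summits.HodgeConjecture.HodgeConjecture.Theorems.K2LiuSphericalSectionLambdaLoc     -- ★ (4c) `isSphericalSection_lambdaLoc` (+ ★ D10, ★ D7c `LambdaLoc`)
import Summits.HodgeConjecture.HodgeConjecture.Theorems.K2LiuUnipDeltaLocBridge           -- ★ B1 `unipDeltaLoc_eq_unipDeltaLocal`
import Summits.HodgeConjecture.HodgeConjecture.Theorems.K2LiuLocalWhittakerFactorSkew     -- ★ `evalPlace_finPart_weylDelta` (`(w_Δ)_v` = ★ D10's `w_Δ`)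
import Summits.HodgeConjecture.HodgeConjecture.Theorems.K2LiuLocalLFactorDefs             -- ★ T1 `aNorm`
import Summits.HodgeConjecture.HodgeConjecture.Theorems.K2LiuSiegelNormaliserTwoOfRecord   -- ★ p862117 `aNorm_two_eq_localScalar_of_record` (ED. 2)
import Summits.HodgeConjecture.HodgeConjecture.Theorems.K2LiuSiegelCocycleSphericalLocalInt  -- ★ (F-GK-3) FILE B `…_of_isGoodPlace` (ED. 3)
import Summits.HodgeConjecture.HodgeConjecture.Theorems.K2LiuA7NormalisedRegularityCM      -- ★ B8-CM `exists_adaptedFrame` (ED. 3)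
import Literature.NumberTheory.Automorphic.Liu2021.LemD1AsPrintedIndexedNonVacuityInertCofinite  -- ★ `valued_toPlace_uniformizer_of_isUnramifiedIn` (ED. 2)
import Literature.NumberTheory.GaloisRepresentations.CMTypeHeckeCharacter                 -- ★ `isUnramifiedAt_iff_forall_valued_eq_one` (ED. 2)
import Literature.NumberTheory.GelbartRogawski1991.LocalDoubledUnitaryGoodPlace            -- ★ `eventually_isGoodPlace`, `eventually_valuation_algebraMap_le_one` (ED. 3)
import Literature.NumberTheory.GelbartRogawski1991.CMSplittingCharLocalComponents         -- ★ `eventually_forall_placesOver_localComponent_inv_eq_one` (ED. 3)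
import Literature.NumberTheory.GelbartRogawski1991.DoubledWeilRepresentationArchLagrangian -- ★ `isUnit_det_gramR₀` (ED. 3)
import HarnessLib

/-!
# Crux `HLiu418`, road `K2_Liu`, #41 KIND 0 (β) Euler face, brick (E4) «GK spherical value», file (F-GK-4), ED. 1:
# THE (d2)-CURRENCY FACE `∫_{N_Δ(L⁺_v)} Λ_{s,v}((w_Δ)_v y) dν_v(y)` AT THE CM DATUM, FROM THE D10-CURRENCY SPHERICAL VALUE

Cell `hodgecm-mathlib`, crux item hLiu418 = `stmt-HodgeConjecture-24832`; squad K2 ∕ K2Liu; prover K2E5-p16 (g8) (lead hand of (E4); desk K2Liu-p13 (g4)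
`CENSUS-Beta-EulerFace` §1 (E4) + 16:33:47Z (B): «keep `χv := fun w => χ.localComponent w.1`»; (F-GK-3) hand K2Liu-p05 (g7); (F-GK-2s) K2Liu-p27 (g0)).
THEOREMS ONLY (no `def`, no instance, no notation, no named-fact hypothesis, no `sorry`); lane `--supports stmt-HodgeConjecture-24832 --as helper`.

THE SEAM.  The consumer ★ (E3) `K2LiuBigCellEulerHead.exists_eulerHead_intertwiningDelta` carries, off `T`, the local factor
`∫ y, LambdaLoc v χ s ((w_Δ)_v * ↑y) ∂(νv v)` over the GLOBAL-COMAP subgroup `unipDeltaLoc v` (★ Φ3b), normalised by `νv v (K_{H,v} ∩ N_Δ) = 1`, with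
`(w_Δ)_v = evalPlace v (finPart w_Δ)`.  The producers ★ (F-GK-2) p862057 `K2LiuSiegelCocycleSphericalValue` ∕ (F-GK-3) `K2LiuSiegelCocycleSphericalValueNormalised`,
`…SphericalLocalInt` (K2Liu-p05) speak ★ D10: `localIntertwining F E c v 2 hJD νN f 1` over `LocalSiegelDoubled.unipDeltaLocal` at the generic doubled datum.
This file is the currency transport at the CM datum `(F, E, c, δ, T₂, J) = (L⁺, L, conj, imagUnit L, gramR, hermD)`, HYPOTHESIS-FIRST on the D10 value (ED. 1):
* §1 `integral_weylDelta_mul_eq_of_localIntertwining_eq` (generic doubled datum, any rank `n`) — a D10 identity `M_v f (1) = R(νN(N_Δ ∩ K_v))` for all Haar `νN`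
  on `unipDeltaLocal` and all spherical `f` transports to ANY subgroup `N′ = unipDeltaLocal` and Haar measure `ν` on `N′` (`subst`, the pattern of ★
  `K2LiuGoodPlaceLocalFactorIntegrable.integrable_weylDelta_mul_of_eq`): `∫_{N′} f(w_Δ u) dν(u) = R(ν(N′ ∩ K_v))`.
* §2 **`integral_lambdaLoc_weylDelta_eq_of_localIntertwining_eq`** (CM datum, `n = 2`): if at `v` the D10 spherical value is `R(vol)` for `χv := (χ.localComponent ·)`
  (binder `hGK` — the head of (F-GK-3)∕(F-GK-2s), to be plugged in ED. 2 with the cofinite good-place guards ★ `eventually_isGoodPlace` ∕ ★ B8-CM frame), then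
  **`∫ y, Λ_{s,v}((w_Δ)_v · y) dν(y) = R(ν{u | ↑u ∈ K_{H,v}})`** for every Haar `ν` on `unipDeltaLoc v` (★ B1 `unipDeltaLoc_eq_unipDeltaLocal`, ★ `evalPlace_finPart_weylDelta`,
  ★ `isSphericalSection_lambdaLoc`); `…_eq_aNorm_…` the `R := aNorm 2 χ_v · s` instance, and **`…_eq_aNorm_one_…`**: under ★ (E3)'s normalisation
  `ν(inH K_H N_Δ v) = 1` the face reads `∫ y, Λ_{s,v}((w_Δ)_v · y) dν(y) = aNorm 2 (χ.localComponent ·) 1 s` — ★ E7 `K2LiuSiegelNormaliserTwoValue` then converts it to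
  ★ O41.6 `hasProd_localScalar`'s `c_v(s)` by name (desk K2Liu-p13 (g4)).
* §3 (ED. 2) **`exists_finset_forall_integral_lambdaLoc_weylDelta_eq_localScalar_of_record`** — AT THE RECORD `χ = toHeckeCharacter L lam⁻¹`, `lam`
  conjugate-symplectic, HYPOTHESIS-FIRST on the COFINITE family of D10 spherical values `hGK : ∀ v ∉ T₁, ∀ s, 1 < re s → (M_v f (1) = aNorm 2 χ_v vol s)`
  ((F-GK-3) FILE B `K2LiuSiegelCocycleSphericalLocalInt` at the CM datum off its finite bad set — plugged by name in ED. 3): there is a finite `T₀ ⊇ T₁` with,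
  for every `v ∉ T₀`, every Haar `ν` on `N_Δ(L⁺_v)` normalised by `ν(K_{H,v} ∩ N_Δ) = 1` and every `1 < re s`,
  **`∫ y, Λ_{s,v}((w_Δ)_v · y) dν(y) = c_v(s) = [(1−q_v^{−(2s+1)})(1−ε(ϖ_v)q_v^{−(2s+2)})]∕[(1−q_v^{−2s})(1−ε(ϖ_v)q_v^{−(2s−1)})]`** (`ε = ε_{L∕L⁺}`,
  `q_v = N v`) — literally the pointwise letter `hI` of ★ `K2LiuBigCellTailScalar.invScalar_mul_tprod_eq_finsetProd_cm`; the side letters of ★ p862117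
  `aNorm_two_eq_localScalar_of_record` (`χ_w` unramified above `v`, `v` unramified in `L`, the uniformiser `ϖ_v` of `L⁺_v` inert at every `w ∣ v`) are
  discharged here cofinitely (★ `isUnramifiedAt_cofinite_holds`, ★ `finite_setOf_not_isUnramifiedIn`, ★ `valued_toPlace_uniformizer_of_isUnramifiedIn`).
* §4 (ED. 3) **`exists_finset_forall_integral_lambdaLoc_weylDelta_eq_localScalar`** — THE SAME WITH `hGK` DISCHARGED (unconditional in `v`): the D10 letter is
  ★ (F-GK-3) FILE B `K2LiuSiegelCocycleSphericalLocalInt.localIntertwining_one_eq_aNorm_of_isSphericalSection_of_isGoodPlace` at the CM datum, in the ONE Δ-adapted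
  frame `(D, D⁻¹, Q)` of `gramR` (★ B8-CM `exists_adaptedFrame`, ★ `gramR_isSymm`, ★ `isUnit_det_gramR₀`), off the finite set where `v` is not a good place for
  `χ_v` (★ `eventually_isGoodPlace`) or a frame entry is not integral (★ `eventually_valuation_algebraMap_le_one`); `hχu` by ★ `norm_localComponent_of_record`
  (`exists_finset_forall_placeLetters_cm`, `exists_frame_finset_forall_placeLetters_cm`).
HONEST LABEL.  `HC_CM` is proved only modulo the 7 printed citations (2 remaining named inputs: hLiu418 = `stmt-HodgeConjecture-24832`,
h413 = `stmt-HodgeConjecture-24833`) until rung 0 closes.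

## References
* [Casselman1980] W. Casselman, *The unramified principal series of p-adic groups I*, Compositio Math. 40 (1980), §3 Thm. 3.1.
* [KudlaSweet1997] S. Kudla, W. J. Sweet, Israel J. Math. 98 (1997), §1.   * [HarrisKudlaSweet1996] M. Harris, S. Kudla, W. J. Sweet, J. AMS 9 (1996), §6 (6.14)–(6.16).
* [Liu2011] Y. Liu, Algebra Number Theory 5 (2011), §2B p. 862, §2C (2-4) p. 863 (the spherical `Λ_{s,v}`, the local factor of `M(s)`).
* [Kudla1994] S. Kudla, Israel J. Math. 87 (1994), §3 (`N_Δ` by block conditions).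
* [Harris2007] M. Harris, in *Eisenstein series and applications*, Progr. Math. 258 (2008), (1.3.4) p. 92 (the scalar `c_v(s)`).
* [TateThesis1967] J. Tate, in Cassels–Fröhlich (1967), Lemma 3.2.1 (almost all local components unramified).
* [NeukirchANT1999] J. Neukirch, *Algebraic Number Theory*, Grundlehren 322 (1999), Ch. III §2 Thm. (2.6) (finitely many ramified primes).
* [GelbartRogawski1991] S. Gelbart, J. Rogawski, Invent. Math. 105 (1991), §3.1 (3.1.3) (the good places of the doubled unitary datum).
* [CasselsFrohlichANT1967] J. W. S. Cassels, A. Fröhlich (eds.), *Algebraic Number Theory* (1967), Ch. II §14 (global elements are local units almost everywhere).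
-/

set_option autoImplicit false
set_option linter.dupNamespace false -- the mandated namespace repeats `HodgeConjecture.HodgeConjecture`

noncomputable section

open scoped NNReal ENNReal
open NumberField IsDedekindDomain Matrix MeasureTheory
open Literature.NumberTheory.Automorphic Literature.NumberTheory.Automorphic.UnitaryGroup Literature.NumberTheory.GaloisRepresentations
open Literature.NumberTheory.GelbartRogawski1991 Literature.NumberTheory.GelbartRogawski1991.GRConstruction
open Literature.NumberTheory.GelbartRogawski1991.AdaptedBlocks
open Literature.NumberTheory.GelbartRogawski1991.UnitaryDualPair Literature.NumberTheory.GelbartRogawski1991.UnitaryDualPair.LocalSplitting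
open Literature.NumberTheory.K2Lit Literature.NumberTheory.K2Lit.SiegelDoubled Literature.NumberTheory.K2Lit.LocalSiegelDoubled
open Literature.Topology.Algebra.RestrictedProduct (inH)
open Summit.HodgeConjecture.HodgeConjecture.Cruxes.HLiu418.K2LiuLocalLFactorDefs
open Summit.HodgeConjecture.HodgeConjecture.Cruxes.HLiu418.K2LiuSiegelUnipotentLocalDefs
open Summit.HodgeConjecture.HodgeConjecture.Cruxes.HLiu418.K2LiuUnipDeltaLocBridge
open Summit.HodgeConjecture.HodgeConjecture.Cruxes.HLiu418.K2LiuLocalWhittakerFactorSkew (evalPlace_finPart_weylDelta)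
open Summit.HodgeConjecture.HodgeConjecture.Cruxes.HLiu418.K2LiuSphericalSectionLambdaLoc (isSphericalSection_lambdaLoc)

namespace Summit.HodgeConjecture.HodgeConjecture.Cruxes.HLiu418.K2LiuSphericalSiegelValueCM

/-! ## §1 Generic doubled datum: transport of a D10 identity to any subgroup equal to `unipDeltaLocal` -/

section Transport

variable (F : Type) [Field F] [NumberField F] (E : Type) [Field E] [NumberField E] [Algebra F E]
  [Algebra.IsQuadraticExtension F E] (c : E ≃ₐ[F] E)
  {δ : E} (hcδ : c δ = -δ) (hδ : δ ≠ 0) {d : F} (hd : δ * δ = algebraMap F E d) (v : HeightOneSpectrum (𝓞 F)) (n : ℕ)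
  {T₀ : Matrix (Fin n) (Fin n) F} (hT₀ : T₀.IsSymm) {JD : Matrix (Fin (n + n)) (Fin (n + n)) E} (hJD : JD = (gramD F n T₀).map (algebraMap F E))

/-- **TRANSPORT OF A D10 SPHERICAL-VALUE IDENTITY TO ANY SUBGROUP `N′ = unipDeltaLocal`** (`subst`): if `M_v f (1) = R(νN{u | ↑u ∈ K_v})` for every Haar
measure `νN` on ★ D10's `unipDeltaLocal` and every spherical section `f` of `I_v(s, χ_v)`, then for every Haar measure `ν` on `N′` and every such `f`,
`∫_{N′} f(w_Δ · u) dν(u) = R(ν{u | ↑u ∈ K_v})`. [cite: Casselman1980, §3] [cite: KudlaSweet1997, §1] -/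
theorem integral_weylDelta_mul_eq_of_localIntertwining_eq
    {N' : Subgroup (UnitaryGroup.localPi E c (n + n) JD v)} (hN' : N' = unipDeltaLocal F E c v n (JD := JD))
    [MeasurableSpace N'] [BorelSpace N'] (ν : Measure N') [ν.IsHaarMeasure]
    (χv : ∀ w : PlacesOver E v, (w.1.adicCompletion E)ˣ →* ℂˣ) (s : ℂ) (R : ℝ → ℂ)
    (hGK : ∀ {_ : MeasurableSpace (unipDeltaLocal F E c v n (JD := JD))} [BorelSpace (unipDeltaLocal F E c v n (JD := JD))]
      (νN : Measure (unipDeltaLocal F E c v n (JD := JD))) [νN.IsHaarMeasure] (f : UnitaryGroup.localPi E c (n + n) JD v → ℂ),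
      IsSphericalSection F E c hcδ hδ hd v n hT₀ hJD χv s f →
        localIntertwining F E c v n hJD νN f 1 = R (νN.real {u | (u : UnitaryGroup.localPi E c (n + n) JD v) ∈ UnitaryGroup.localInt E c (n + n) JD v}))
    {f : UnitaryGroup.localPi E c (n + n) JD v → ℂ} (hf : IsSphericalSection F E c hcδ hδ hd v n hT₀ hJD χv s f) :
    ∫ u : N', f (weylDelta F E c v n hJD * (u : UnitaryGroup.localPi E c (n + n) JD v)) ∂ν =
      R (ν.real {u : N' | (u : UnitaryGroup.localPi E c (n + n) JD v) ∈ UnitaryGroup.localInt E c (n + n) JD v}) := by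
  subst hN'
  have h := hGK ν f hf
  unfold localIntertwining at h
  simpa only [mul_one] using h

end Transport

/-! ## §2 The CM datum: the (d2)-currency face from the D10 spherical value -/

section CM

variable (L : Type) [Field L] [NumberField L] [IsCMField L] {N M : ℕ} (e : Fin N × Fin M ≃ Fin 2)
  (dV : Fin N → L) (hdV : ∀ i, IsCMField.complexConj L (dV i) = dV i)
  (dW : Fin M → L) (hdW : ∀ i, IsCMField.complexConj L (dW i) = dW i)
  (v : HeightOneSpectrum (𝓞 (Fp L)))
  [MeasurableSpace ↥(unipDeltaLoc L e dV hdV dW hdW v)] [BorelSpace ↥(unipDeltaLoc L e dV hdV dW hdW v)] (ν : Measure ↥(unipDeltaLoc L e dV hdV dW hdW v)) [ν.IsHaarMeasure]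
  (χ : HeckeCharacter L) (hχ : ∀ w : UnitaryGroup.PlacesOver L v, χ.IsUnramifiedAt w.1) (s : ℂ)

include hχ in
set_option maxHeartbeats 800000 in -- MEASURED: probes 200 000 ✗ (`whnf`) ∕ 400 000 ✗ (`isDefEq` at the `exact`) ∕ 800 000 ✓ (the K2Lit CM datum's binder telescope, same class as ★ G2 `K2LiuGoodPlaceLocalFactorIntegrable`); plain `rw`∕`exact`
/-- **THE (d2) FACE FROM THE D10 SPHERICAL VALUE, CM DATUM** (hypothesis-first): if at `v` the Siegel intertwining operator of `H_v = U(𝕎 ⊕ −𝕎)(L⁺_v)` takes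
the value `M_v f (1) = R(νN{u | ↑u ∈ K_{H,v}})` on every spherical section `f` of `I_v(s, (χ.localComponent ·))` for every Haar `νN` (binder `hGK` — (F-GK-3)'s head at a
good place), then for every Haar measure `ν` on the global-comap `N_Δ(L⁺_v) = unipDeltaLoc v`:
**`∫ y, Λ_{s,v}((w_Δ)_v · y) dν(y) = R(ν{u | ↑u ∈ K_{H,v}})`** (`Λ_{s,v}` is spherical ★ `isSphericalSection_lambdaLoc`; `(w_Δ)_v` ★ `evalPlace_finPart_weylDelta`; subgroup ★ B1).
[cite: Liu2011, §2B p. 862] [cite: Casselman1980, §3 Thm. 3.1] [cite: KudlaSweet1997, §1] -/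
theorem integral_lambdaLoc_weylDelta_eq_of_localIntertwining_eq (R : ℝ → ℂ)
    (hGK : haveI : Algebra.IsQuadraticExtension (Fp L) L := IsCMField.isQuadraticExtension L
      ∀ {_ : MeasurableSpace ↥(unipDeltaLocal (Fp L) L (IsCMField.complexConj L) v 2 (JD := hermD L e dV hdV dW hdW))} [BorelSpace ↥(unipDeltaLocal (Fp L) L (IsCMField.complexConj L) v 2 (JD := hermD L e dV hdV dW hdW))] (νN : Measure ↥(unipDeltaLocal (Fp L) L (IsCMField.complexConj L) v 2 (JD := hermD L e dV hdV dW hdW))) [νN.IsHaarMeasure] (f : UnitaryGroup.localPi L (IsCMField.complexConj L) (2 + 2) (hermD L e dV hdV dW hdW) v → ℂ),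
        IsSphericalSection (Fp L) L (IsCMField.complexConj L) (complexConj_imagUnit L) (imagUnit_ne_zero L) (imagUnit_mul_self L) v 2 (gramR_isSymm L e dV hdV dW hdW) (hermD_eq_map_gramD L e dV hdV dW hdW) (fun w : UnitaryGroup.PlacesOver L v => χ.localComponent w.1) s f →
          localIntertwining (Fp L) L (IsCMField.complexConj L) v 2 (hermD_eq_map_gramD L e dV hdV dW hdW) νN f 1 = R (νN.real {u | (u : UnitaryGroup.localPi L (IsCMField.complexConj L) (2 + 2) (hermD L e dV hdV dW hdW) v) ∈ UnitaryGroup.localInt L (IsCMField.complexConj L) (2 + 2) (hermD L e dV hdV dW hdW) v})) :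
    ∫ y, LambdaLoc L e dV hdV dW hdW v χ s (UnitaryGroup.evalPlace (Fp L) L (IsCMField.complexConj L) (2 + 2) (hermD L e dV hdV dW hdW) v (UnitaryGroup.finPart (Fp L) L (IsCMField.complexConj L) (2 + 2) (hermD L e dV hdV dW hdW) (SiegelDoubled.weylDelta L e dV hdV dW hdW)) * (y : UnitaryGroup.localPi L (IsCMField.complexConj L) (2 + 2) (hermD L e dV hdV dW hdW) v)) ∂ν = R (ν.real {u | (u : UnitaryGroup.localPi L (IsCMField.complexConj L) (2 + 2) (hermD L e dV hdV dW hdW) v) ∈ UnitaryGroup.localInt L (IsCMField.complexConj L) (2 + 2) (hermD L e dV hdV dW hdW) v}) := by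
  haveI : Algebra.IsQuadraticExtension (Fp L) L := IsCMField.isQuadraticExtension L
  rw [evalPlace_finPart_weylDelta]
  exact integral_weylDelta_mul_eq_of_localIntertwining_eq (Fp L) L (IsCMField.complexConj L) (complexConj_imagUnit L) (imagUnit_ne_zero L) (imagUnit_mul_self L) v 2
    (gramR_isSymm L e dV hdV dW hdW) (hermD_eq_map_gramD L e dV hdV dW hdW) (unipDeltaLoc_eq_unipDeltaLocal L e dV hdV dW hdW v) ν _ s R hGK
    (isSphericalSection_lambdaLoc L e dV hdV dW hdW v χ s hχ)

include hχ in
/-- **THE (d2) FACE IN `aNorm` CURRENCY**: with `R := aNorm 2 (χ.localComponent ·) · s` — `∫ y, Λ_{s,v}((w_Δ)_v · y) dν(y) = aNorm 2 χ_v (ν{u | ↑u ∈ K_{H,v}}) s`,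
`aNorm 2 χ_v vol s = vol · L_F(2s−1,χ_F)L_F(2s,χ_Fη) ∕ (L_F(2s+2,χ_F)L_F(2s+1,χ_Fη))` (★ T1 `aNorm_two`). [cite: HarrisKudlaSweet1996, §6 (6.14)–(6.16)] [cite: Liu2011, §2C (2-4) p. 863] -/
theorem integral_lambdaLoc_weylDelta_eq_aNorm_of_localIntertwining_eq
    (hGK : haveI : Algebra.IsQuadraticExtension (Fp L) L := IsCMField.isQuadraticExtension L
      ∀ {_ : MeasurableSpace ↥(unipDeltaLocal (Fp L) L (IsCMField.complexConj L) v 2 (JD := hermD L e dV hdV dW hdW))} [BorelSpace ↥(unipDeltaLocal (Fp L) L (IsCMField.complexConj L) v 2 (JD := hermD L e dV hdV dW hdW))] (νN : Measure ↥(unipDeltaLocal (Fp L) L (IsCMField.complexConj L) v 2 (JD := hermD L e dV hdV dW hdW))) [νN.IsHaarMeasure] (f : UnitaryGroup.localPi L (IsCMField.complexConj L) (2 + 2) (hermD L e dV hdV dW hdW) v → ℂ),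
        IsSphericalSection (Fp L) L (IsCMField.complexConj L) (complexConj_imagUnit L) (imagUnit_ne_zero L) (imagUnit_mul_self L) v 2 (gramR_isSymm L e dV hdV dW hdW) (hermD_eq_map_gramD L e dV hdV dW hdW) (fun w : UnitaryGroup.PlacesOver L v => χ.localComponent w.1) s f →
          localIntertwining (Fp L) L (IsCMField.complexConj L) v 2 (hermD_eq_map_gramD L e dV hdV dW hdW) νN f 1 =
            aNorm (Fp L) L (IsCMField.complexConj L) v 2 (fun w : UnitaryGroup.PlacesOver L v => χ.localComponent w.1) (νN.real {u | (u : UnitaryGroup.localPi L (IsCMField.complexConj L) (2 + 2) (hermD L e dV hdV dW hdW) v) ∈ UnitaryGroup.localInt L (IsCMField.complexConj L) (2 + 2) (hermD L e dV hdV dW hdW) v}) s) :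
    ∫ y, LambdaLoc L e dV hdV dW hdW v χ s (UnitaryGroup.evalPlace (Fp L) L (IsCMField.complexConj L) (2 + 2) (hermD L e dV hdV dW hdW) v (UnitaryGroup.finPart (Fp L) L (IsCMField.complexConj L) (2 + 2) (hermD L e dV hdV dW hdW) (SiegelDoubled.weylDelta L e dV hdV dW hdW)) * (y : UnitaryGroup.localPi L (IsCMField.complexConj L) (2 + 2) (hermD L e dV hdV dW hdW) v)) ∂ν =
      aNorm (Fp L) L (IsCMField.complexConj L) v 2 (fun w : UnitaryGroup.PlacesOver L v => χ.localComponent w.1) (ν.real {u | (u : UnitaryGroup.localPi L (IsCMField.complexConj L) (2 + 2) (hermD L e dV hdV dW hdW) v) ∈ UnitaryGroup.localInt L (IsCMField.complexConj L) (2 + 2) (hermD L e dV hdV dW hdW) v}) s :=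
  integral_lambdaLoc_weylDelta_eq_of_localIntertwining_eq L e dV hdV dW hdW v ν χ hχ s
    (fun vol => aNorm (Fp L) L (IsCMField.complexConj L) v 2 (fun w : UnitaryGroup.PlacesOver L v => χ.localComponent w.1) vol s) hGK

omit [BorelSpace ↥(unipDeltaLoc L e dV hdV dW hdW v)] [ν.IsHaarMeasure] in
/-- ★ (E3)'s normalisation letter in volume form: `ν(inH K_H N_Δ v) = 1` reads `ν.real {u | ↑u ∈ K_{H,v}} = 1` (`inH B H v = (B v).subgroupOf (H v)`).
[cite: Liu2011, §2B p. 862] -/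
theorem measureReal_localInt_eq_one
    (hνK : ν (((inH (fun v => UnitaryGroup.localInt L (IsCMField.complexConj L) (2 + 2) (hermD L e dV hdV dW hdW) v) (fun v => unipDeltaLoc L e dV hdV dW hdW v) v) :
      Subgroup ↥(unipDeltaLoc L e dV hdV dW hdW v)) : Set ↥(unipDeltaLoc L e dV hdV dW hdW v)) = 1) :
    ν.real {u | (u : UnitaryGroup.localPi L (IsCMField.complexConj L) (2 + 2) (hermD L e dV hdV dW hdW) v) ∈ UnitaryGroup.localInt L (IsCMField.complexConj L) (2 + 2) (hermD L e dV hdV dW hdW) v} = 1 := by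
  have hset : {u : ↥(unipDeltaLoc L e dV hdV dW hdW v) | (u : UnitaryGroup.localPi L (IsCMField.complexConj L) (2 + 2) (hermD L e dV hdV dW hdW) v) ∈ UnitaryGroup.localInt L (IsCMField.complexConj L) (2 + 2) (hermD L e dV hdV dW hdW) v} =
      (((inH (fun v => UnitaryGroup.localInt L (IsCMField.complexConj L) (2 + 2) (hermD L e dV hdV dW hdW) v) (fun v => unipDeltaLoc L e dV hdV dW hdW v) v) :
        Subgroup ↥(unipDeltaLoc L e dV hdV dW hdW v)) : Set ↥(unipDeltaLoc L e dV hdV dW hdW v)) := by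
    ext u
    simp only [Set.mem_setOf_eq, SetLike.mem_coe, Subgroup.mem_subgroupOf]
  rw [measureReal_def, hset, hνK, ENNReal.toReal_one]

include hχ in
/-- **THE (E4) FACE UNDER ★ (E3)'s NORMALISATION** `ν(K_{H,v} ∩ N_Δ(L⁺_v)) = 1`: `∫ y, Λ_{s,v}((w_Δ)_v · y) dν(y) = aNorm 2 (χ.localComponent ·) 1 s` — modulo the D10
spherical value `hGK` at `v` ((F-GK-3), good places; ED. 2 discharges it cofinitely).  ★ E7 `K2LiuSiegelNormaliserTwoValue` turns the right-hand side into ★ O41.6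
`hasProd_localScalar`'s `c_v(s) = [(1−q_v^{−(2s+1)})(1−ε_v q_v^{−(2s+2)})]∕[(1−q_v^{−2s})(1−ε_v q_v^{−(2s−1)})]`. [cite: Liu2011, §2C (2-4) p. 863] [cite: HarrisKudlaSweet1996, §6 (6.16)] -/
theorem integral_lambdaLoc_weylDelta_eq_aNorm_one_of_localIntertwining_eq
    (hνK : ν (((inH (fun v => UnitaryGroup.localInt L (IsCMField.complexConj L) (2 + 2) (hermD L e dV hdV dW hdW) v) (fun v => unipDeltaLoc L e dV hdV dW hdW v) v) :
      Subgroup ↥(unipDeltaLoc L e dV hdV dW hdW v)) : Set ↥(unipDeltaLoc L e dV hdV dW hdW v)) = 1)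
    (hGK : haveI : Algebra.IsQuadraticExtension (Fp L) L := IsCMField.isQuadraticExtension L
      ∀ {_ : MeasurableSpace ↥(unipDeltaLocal (Fp L) L (IsCMField.complexConj L) v 2 (JD := hermD L e dV hdV dW hdW))} [BorelSpace ↥(unipDeltaLocal (Fp L) L (IsCMField.complexConj L) v 2 (JD := hermD L e dV hdV dW hdW))] (νN : Measure ↥(unipDeltaLocal (Fp L) L (IsCMField.complexConj L) v 2 (JD := hermD L e dV hdV dW hdW))) [νN.IsHaarMeasure] (f : UnitaryGroup.localPi L (IsCMField.complexConj L) (2 + 2) (hermD L e dV hdV dW hdW) v → ℂ),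
        IsSphericalSection (Fp L) L (IsCMField.complexConj L) (complexConj_imagUnit L) (imagUnit_ne_zero L) (imagUnit_mul_self L) v 2 (gramR_isSymm L e dV hdV dW hdW) (hermD_eq_map_gramD L e dV hdV dW hdW) (fun w : UnitaryGroup.PlacesOver L v => χ.localComponent w.1) s f →
          localIntertwining (Fp L) L (IsCMField.complexConj L) v 2 (hermD_eq_map_gramD L e dV hdV dW hdW) νN f 1 =
            aNorm (Fp L) L (IsCMField.complexConj L) v 2 (fun w : UnitaryGroup.PlacesOver L v => χ.localComponent w.1) (νN.real {u | (u : UnitaryGroup.localPi L (IsCMField.complexConj L) (2 + 2) (hermD L e dV hdV dW hdW) v) ∈ UnitaryGroup.localInt L (IsCMField.complexConj L) (2 + 2) (hermD L e dV hdV dW hdW) v}) s) :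
    ∫ y, LambdaLoc L e dV hdV dW hdW v χ s (UnitaryGroup.evalPlace (Fp L) L (IsCMField.complexConj L) (2 + 2) (hermD L e dV hdV dW hdW) v (UnitaryGroup.finPart (Fp L) L (IsCMField.complexConj L) (2 + 2) (hermD L e dV hdV dW hdW) (SiegelDoubled.weylDelta L e dV hdV dW hdW)) * (y : UnitaryGroup.localPi L (IsCMField.complexConj L) (2 + 2) (hermD L e dV hdV dW hdW) v)) ∂ν = aNorm (Fp L) L (IsCMField.complexConj L) v 2 (fun w : UnitaryGroup.PlacesOver L v => χ.localComponent w.1) 1 s := by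
  rw [integral_lambdaLoc_weylDelta_eq_aNorm_of_localIntertwining_eq L e dV hdV dW hdW v ν χ hχ s hGK,
    measureReal_localInt_eq_one L e dV hdV dW hdW v ν hνK]

end CM

/-! ## §3 (ED. 2) At the record `χ = toHeckeCharacter L lam⁻¹`: the (E4) face IS the Gindikin–Karpelevich scalar `c_v(s)`, cofinitely -/

section Record

open Literature.NumberTheory.Automorphic.IdeleClassGroup (IsConjugateSymplectic toHeckeCharacter)
open Literature.NumberTheory.Automorphic.Liu2021.LemD1IndexedNonVacuityInertCofinite (valued_toPlace_uniformizer_of_isUnramifiedIn)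
open Summit.HodgeConjecture.HodgeConjecture.Cruxes.HLiu418.K2LiuSiegelNormaliserTwoOfRecord (aNorm_two_eq_localScalar_of_record)

variable (L : Type) [Field L] [NumberField L] [IsCMField L] {N M : ℕ} (e : Fin N × Fin M ≃ Fin 2)
  (dV : Fin N → L) (hdV : ∀ i, IsCMField.complexConj L (dV i) = dV i)
  (dW : Fin M → L) (hdW : ∀ i, IsCMField.complexConj L (dW i) = dW i)
  [∀ v : HeightOneSpectrum (𝓞 (Fp L)), MeasurableSpace ↥(unipDeltaLoc L e dV hdV dW hdW v)]
  [∀ v : HeightOneSpectrum (𝓞 (Fp L)), BorelSpace ↥(unipDeltaLoc L e dV hdV dW hdW v)]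

omit [IsCMField L] in
/-- **THE TWO RECORD LETTERS ARE COFINITE**: off a finite set of places `v` of `L⁺`, a Hecke character `χ` of `L` is unramified at every `w ∣ v` (also in the
valued form `v_w(u) = 1 ⇒ χ_w(u) = 1` of ★ `aNorm_two_eq_localScalar_of_record`'s `hχur`) AND `v` is unramified in `L` (★ `isUnramifiedAt_cofinite_holds` under
★ `eventually_forall_placesOver`; ★ `finite_setOf_not_isUnramifiedIn`). [cite: TateThesis1967, Lemma 3.2.1] [cite: NeukirchANT1999, Ch. III §2 Thm. (2.6)] -/
theorem exists_finset_forall_record_letters (χ : HeckeCharacter L) :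
    ∃ T₂ : Finset (HeightOneSpectrum (𝓞 (Fp L))), ∀ v ∉ T₂,
      (∀ w : UnitaryGroup.PlacesOver L v, χ.IsUnramifiedAt w.1) ∧
      (∀ (w : UnitaryGroup.PlacesOver L v) (u : (w.1.adicCompletion L)ˣ), Valued.v (u : w.1.adicCompletion L) = 1 → χ.localComponent w.1 u = 1) ∧
      Algebra.IsUnramifiedIn (𝓞 L) v.asIdeal := by
  have hur : ∀ᶠ v : HeightOneSpectrum (𝓞 (Fp L)) in Filter.cofinite, ∀ w : UnitaryGroup.PlacesOver L v, χ.IsUnramifiedAt w.1 :=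
    UnitaryGroup.eventually_forall_placesOver (F := Fp L) L (Q := fun w => χ.IsUnramifiedAt w) (HeckeCharacter.isUnramifiedAt_cofinite_holds χ)
  have hunr : ∀ᶠ v : HeightOneSpectrum (𝓞 (Fp L)) in Filter.cofinite, Algebra.IsUnramifiedIn (𝓞 L) v.asIdeal :=
    Filter.eventually_cofinite.2 (finite_setOf_not_isUnramifiedIn (Fp L) L)
  refine ⟨(Filter.eventually_cofinite.1 (hur.and hunr)).toFinset, fun v hv => ?_⟩
  have h : (∀ w : UnitaryGroup.PlacesOver L v, χ.IsUnramifiedAt w.1) ∧ Algebra.IsUnramifiedIn (𝓞 L) v.asIdeal := by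
    by_contra h
    exact hv ((Set.Finite.mem_toFinset _).2 h)
  refine ⟨h.1, fun w u hu => ?_, h.2⟩
  rw [HeckeCharacter.localComponent_apply]
  exact HeckeCharacter.isUnramifiedAt_iff_forall_valued_eq_one.1 (h.1 w) u hu

set_option maxHeartbeats 400000 in -- MEASURED: 200 000 ✗ (`whnf` while elaborating the statement's `hGK` telescope — §2's class) ∕ 400 000 ✓; plain `rw`
/-- **(F-GK-4) ED. 2 — THE (E4) FACE AT THE RECORD, COFINITELY, IN THE `c_v(s)` CURRENCY.**  Let `lam : C_L → S¹` be conjugate-symplectic and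
`χ = toHeckeCharacter L lam⁻¹` (the #41 TOP's character of record).  HYPOTHESIS-FIRST on the cofinite family of D10 spherical values `hGK` (off the finite
set `T₁`: at `v ∉ T₁`, for `1 < re s`, the Siegel intertwining operator of `H_v` takes the value `aNorm 2 (χ_w)_{w∣v} (νN{u | ↑u ∈ K_{H,v}}) s` at `1` on every
spherical section — the head of (F-GK-3) FILE B at the CM datum, whose bad set is finite by ★ `eventually_isGoodPlace` and the ★ B8-CM frame's cofinite
integrality; ED. 3 plugs it by name).  CONCLUSION (the letter `hI` of ★ `K2LiuBigCellTailScalar.invScalar_mul_tprod_eq_finsetProd_cm`, pointwise): there is a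
finite `T₀` such that for every `v ∉ T₀`, every Haar measure `ν` on `N_Δ(L⁺_v) = unipDeltaLoc v` with ★ (E3)'s normalisation `ν(K_{H,v} ∩ N_Δ(L⁺_v)) = 1`, and
every `1 < re s`,
**`∫ y, Λ_{s,v}((w_Δ)_v · y) dν(y) = [(1 − q_v^{−(2s+1)})(1 − ε(ϖ_v) q_v^{−(2s+2)})] ∕ [(1 − q_v^{−2s})(1 − ε(ϖ_v) q_v^{−(2s−1)})]`**, `ε = ε_{L∕L⁺}` (`quadraticHeckeCharCM L`),
`q_v = N v` — §2 `…_eq_aNorm_one_…` composed with ★ p862117 `aNorm_two_eq_localScalar_of_record (vol := 1)`, its side letters discharged by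
`exists_finset_forall_record_letters` and the inert uniformiser ★ `valued_toPlace_uniformizer_of_isUnramifiedIn` (`T₀ = T₁ ∪ T₂`).
[cite: Liu2011, §2C (2-4) p. 863] [cite: HarrisKudlaSweet1996, §6 (6.14)–(6.16)] [cite: Harris2007, (1.3.4) p. 92] [cite: Casselman1980, §3 Thm. 3.1] -/
theorem exists_finset_forall_integral_lambdaLoc_weylDelta_eq_localScalar_of_record
    {lam : IdeleClassGroup L →ₜ* Circle} (hlam : IsConjugateSymplectic L lam) (T₁ : Finset (HeightOneSpectrum (𝓞 (Fp L))))
    (hGK : ∀ v ∉ T₁, ∀ s : ℂ, 1 < s.re → haveI : Algebra.IsQuadraticExtension (Fp L) L := IsCMField.isQuadraticExtension L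
      ∀ {_ : MeasurableSpace ↥(unipDeltaLocal (Fp L) L (IsCMField.complexConj L) v 2 (JD := hermD L e dV hdV dW hdW))} [BorelSpace ↥(unipDeltaLocal (Fp L) L (IsCMField.complexConj L) v 2 (JD := hermD L e dV hdV dW hdW))] (νN : Measure ↥(unipDeltaLocal (Fp L) L (IsCMField.complexConj L) v 2 (JD := hermD L e dV hdV dW hdW))) [νN.IsHaarMeasure] (f : UnitaryGroup.localPi L (IsCMField.complexConj L) (2 + 2) (hermD L e dV hdV dW hdW) v → ℂ),
        IsSphericalSection (Fp L) L (IsCMField.complexConj L) (complexConj_imagUnit L) (imagUnit_ne_zero L) (imagUnit_mul_self L) v 2 (gramR_isSymm L e dV hdV dW hdW) (hermD_eq_map_gramD L e dV hdV dW hdW) (fun w : UnitaryGroup.PlacesOver L v => (toHeckeCharacter L lam⁻¹).localComponent w.1) s f →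
          localIntertwining (Fp L) L (IsCMField.complexConj L) v 2 (hermD_eq_map_gramD L e dV hdV dW hdW) νN f 1 =
            aNorm (Fp L) L (IsCMField.complexConj L) v 2 (fun w : UnitaryGroup.PlacesOver L v => (toHeckeCharacter L lam⁻¹).localComponent w.1) (νN.real {u | (u : UnitaryGroup.localPi L (IsCMField.complexConj L) (2 + 2) (hermD L e dV hdV dW hdW) v) ∈ UnitaryGroup.localInt L (IsCMField.complexConj L) (2 + 2) (hermD L e dV hdV dW hdW) v}) s) :
    ∃ T₀ : Finset (HeightOneSpectrum (𝓞 (Fp L))), ∀ v ∉ T₀,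
      ∀ (ν : Measure ↥(unipDeltaLoc L e dV hdV dW hdW v)) [ν.IsHaarMeasure],
        ν (((inH (fun v => UnitaryGroup.localInt L (IsCMField.complexConj L) (2 + 2) (hermD L e dV hdV dW hdW) v) (fun v => unipDeltaLoc L e dV hdV dW hdW v) v) :
          Subgroup ↥(unipDeltaLoc L e dV hdV dW hdW v)) : Set ↥(unipDeltaLoc L e dV hdV dW hdW v)) = 1 →
        ∀ s : ℂ, 1 < s.re →
          ∫ y, LambdaLoc L e dV hdV dW hdW v (toHeckeCharacter L lam⁻¹) s (UnitaryGroup.evalPlace (Fp L) L (IsCMField.complexConj L) (2 + 2) (hermD L e dV hdV dW hdW) v (UnitaryGroup.finPart (Fp L) L (IsCMField.complexConj L) (2 + 2) (hermD L e dV hdV dW hdW) (SiegelDoubled.weylDelta L e dV hdV dW hdW)) * (y : UnitaryGroup.localPi L (IsCMField.complexConj L) (2 + 2) (hermD L e dV hdV dW hdW) v)) ∂ν =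
            ((1 - (v.residueCard : ℂ) ^ (-(2 * s + 1))) * (1 - (quadraticHeckeCharCM L).valueAtUniformizer v * (v.residueCard : ℂ) ^ (-(2 * s + 2)))) /
              ((1 - (v.residueCard : ℂ) ^ (-(2 * s))) * (1 - (quadraticHeckeCharCM L).valueAtUniformizer v * (v.residueCard : ℂ) ^ (-(2 * s - 1)))) := by
  classical
  obtain ⟨T₂, hT₂⟩ := exists_finset_forall_record_letters L (toHeckeCharacter L lam⁻¹)
  refine ⟨T₁ ∪ T₂, fun v hv ν _ hνK s hs => ?_⟩
  rw [Finset.mem_union, not_or] at hv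
  obtain ⟨hχT, hχur, hunr⟩ := hT₂ v hv.2
  rw [integral_lambdaLoc_weylDelta_eq_aNorm_one_of_localIntertwining_eq L e dV hdV dW hdW v ν (toHeckeCharacter L lam⁻¹) hχT s hνK (hGK v hv.1 s hs),
    aNorm_two_eq_localScalar_of_record L v (HeckeCharacter.valued_uniformizer (K := Fp L) v) (valued_toPlace_uniformizer_of_isUnramifiedIn L v hunr)
      hlam hχur hunr (Classical.arbitrary (UnitaryGroup.PlacesOver L v)) 1 (zero_lt_one.trans hs),
    Complex.ofReal_one, one_mul]

end Record

/-! ## §4 (ED. 3) The D10 letter discharged: ★ (F-GK-3) FILE B at the CM datum in the ★ B8-CM frame, off a finite set of places -/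

section Unconditional

open Literature.NumberTheory.Automorphic.IdeleClassGroup (IsConjugateSymplectic toHeckeCharacter)
open Summit.HodgeConjecture.HodgeConjecture.Cruxes.HLiu418.K2LiuSiegelNormaliserTwoOfRecord (norm_localComponent_of_record)
open Summit.HodgeConjecture.HodgeConjecture.Cruxes.HLiu418.K2LiuA7NormalisedRegularityCM (exists_adaptedFrame)
open Summit.HodgeConjecture.HodgeConjecture.Cruxes.HLiu418.K2LiuSiegelCocycleSphericalLocalInt (localIntertwining_one_eq_aNorm_of_isSphericalSection_of_isGoodPlace)

variable (L : Type) [Field L] [NumberField L] [IsCMField L] {N M : ℕ} (e : Fin N × Fin M ≃ Fin 2)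
  (dV : Fin N → L) (hdV : ∀ i, IsCMField.complexConj L (dV i) = dV i)
  (dW : Fin M → L) (hdW : ∀ i, IsCMField.complexConj L (dW i) = dW i)

/-- **FILE B's PLACE LETTERS HOLD COFINITELY AT THE CM DATUM**: for a Hecke character `χ` of `L` and a frame `D`, `D⁻¹` over `L⁺`, off a finite set of places `v` of `L⁺`,
`v` is a good place of the doubled CM datum for `χ_v := (χ_w)_{w∣v}` (★ `eventually_isGoodPlace`: `|2|_w = |δ|_w = 1`, `gramR` integral with unit determinant
★ `isUnit_det_gramR₀`, `χ_w` unramified — ★ `eventually_forall_placesOver_localComponent_inv_eq_one`, `ψ_v` of conductor `𝒪_v`) AND every entry of `D`, `D⁻¹` is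
`w`-integral at every `w ∣ v` (★ `eventually_valuation_algebraMap_le_one` under ★ `eventually_forall_placesOver`).
[cite: GelbartRogawski1991, §3.1 (3.1.3)] [cite: CasselsFrohlichANT1967, Ch. II §14] -/
theorem exists_finset_forall_placeLetters_cm (hdV0 : ∀ i, dV i ≠ 0) (hdW0 : ∀ i, dW i ≠ 0) (χ : HeckeCharacter L) (D Dinv : Matrix (Fin 2) (Fin 2) (Fp L)) :
    ∃ T₁ : Finset (HeightOneSpectrum (𝓞 (Fp L))), ∀ v ∉ T₁,
      IsGoodPlace (Fp L) L (imagUnit L) v 2 (gramR L e dV hdV dW hdW) (fun w : UnitaryGroup.PlacesOver L v => χ.localComponent w.1) ∧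
      (∀ (w : UnitaryGroup.PlacesOver L v) (i j : Fin 2),
        ValuativeRel.valuation (w.1.adicCompletion L) (algebraMap L (w.1.adicCompletion L) (algebraMap (Fp L) L (D i j))) ≤ 1) ∧
      (∀ (w : UnitaryGroup.PlacesOver L v) (i j : Fin 2),
        ValuativeRel.valuation (w.1.adicCompletion L) (algebraMap L (w.1.adicCompletion L) (algebraMap (Fp L) L (Dinv i j))) ≤ 1) := by
  have hχ1 : ∀ᶠ v : HeightOneSpectrum (𝓞 (Fp L)) in Filter.cofinite, ∀ (w : UnitaryGroup.PlacesOver L v) (u : (w.1.adicCompletion L)ˣ),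
      ValuativeRel.valuation (w.1.adicCompletion L) (u : w.1.adicCompletion L) = 1 → χ.localComponent w.1 u = 1 := by
    filter_upwards [eventually_forall_placesOver_localComponent_inv_eq_one L χ] with v hv w u hu
    simpa only [MonoidHom.inv_apply, inv_eq_one] using hv w u hu
  have hgood := eventually_isGoodPlace (Fp L) L (imagUnit L) 2 (gramR L e dV hdV dW hdW) (imagUnit_ne_zero L)
    (isUnit_det_gramR₀ L e dV hdV hdV0 dW hdW hdW0) (fun v (w : UnitaryGroup.PlacesOver L v) => χ.localComponent w.1) hχ1
  have hD : ∀ᶠ v : HeightOneSpectrum (𝓞 (Fp L)) in Filter.cofinite, ∀ (w : UnitaryGroup.PlacesOver L v) (i j : Fin 2),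
      ValuativeRel.valuation (w.1.adicCompletion L) (algebraMap L (w.1.adicCompletion L) (algebraMap (Fp L) L (D i j))) ≤ 1 := by
    refine UnitaryGroup.eventually_forall_placesOver (F := Fp L) L
      (Q := fun w => ∀ i j : Fin 2, ValuativeRel.valuation (w.adicCompletion L) (algebraMap L (w.adicCompletion L) (algebraMap (Fp L) L (D i j))) ≤ 1) ?_
    simp only [Filter.eventually_all]
    exact fun i j => UnitaryDualPair.LocalSplitting.eventually_valuation_algebraMap_le_one L _
  have hDi : ∀ᶠ v : HeightOneSpectrum (𝓞 (Fp L)) in Filter.cofinite, ∀ (w : UnitaryGroup.PlacesOver L v) (i j : Fin 2),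
      ValuativeRel.valuation (w.1.adicCompletion L) (algebraMap L (w.1.adicCompletion L) (algebraMap (Fp L) L (Dinv i j))) ≤ 1 := by
    refine UnitaryGroup.eventually_forall_placesOver (F := Fp L) L
      (Q := fun w => ∀ i j : Fin 2, ValuativeRel.valuation (w.adicCompletion L) (algebraMap L (w.adicCompletion L) (algebraMap (Fp L) L (Dinv i j))) ≤ 1) ?_
    simp only [Filter.eventually_all]
    exact fun i j => UnitaryDualPair.LocalSplitting.eventually_valuation_algebraMap_le_one L _
  refine ⟨(Filter.eventually_cofinite.1 ((hgood.and hD).and hDi)).toFinset, fun v hv => ?_⟩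
  by_contra h
  refine hv ((Set.Finite.mem_toFinset _).2 ?_)
  simpa only [Set.mem_setOf_eq, and_assoc] using h

/-- **ONE FRAME AND ONE FINITE BAD SET, CM DATUM**: a Δ-adapted frame `(D, D⁻¹, Q)` of `T = gramR` (`D D⁻¹ = D⁻¹ D = 1`, `Q = e₂ ∘ (1 D; 1 −D)`, `Qᵀ (T ⊕ −T) Q = J₄`;
★ B8-CM `exists_adaptedFrame` with ★ `gramR_isSymm`, ★ `isUnit_det_gramR₀`) together with a finite `T₁` off which all of FILE B's place letters hold
(`exists_finset_forall_placeLetters_cm`). [cite: HarrisKudlaSweet1996, §1 (1.11)] [cite: GelbartRogawski1991, §3.1 (3.1.3)] -/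
theorem exists_frame_finset_forall_placeLetters_cm (hdV0 : ∀ i, dV i ≠ 0) (hdW0 : ∀ i, dW i ≠ 0) (χ : HeckeCharacter L) :
    ∃ (D Dinv : Matrix (Fin 2) (Fin 2) (Fp L)) (Q : GL (Fin (2 + 2)) (Fp L)), D * Dinv = 1 ∧ Dinv * D = 1 ∧
      (Q : Matrix (Fin (2 + 2)) (Fin (2 + 2)) (Fp L)) = Matrix.reindex (e₂ 2) (e₂ 2) (Matrix.fromBlocks 1 D 1 (-D)) ∧
      (Q : Matrix (Fin (2 + 2)) (Fin (2 + 2)) (Fp L))ᵀ * gramD (Fp L) 2 (gramR L e dV hdV dW hdW) * (Q : Matrix (Fin (2 + 2)) (Fin (2 + 2)) (Fp L)) =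
        (StdForm.antidiagonal (2 + 2)).over (Fp L) ∧
      ∃ T₁ : Finset (HeightOneSpectrum (𝓞 (Fp L))), ∀ v ∉ T₁,
        IsGoodPlace (Fp L) L (imagUnit L) v 2 (gramR L e dV hdV dW hdW) (fun w : UnitaryGroup.PlacesOver L v => χ.localComponent w.1) ∧
        (∀ (w : UnitaryGroup.PlacesOver L v) (i j : Fin 2),
          ValuativeRel.valuation (w.1.adicCompletion L) (algebraMap L (w.1.adicCompletion L) (algebraMap (Fp L) L (D i j))) ≤ 1) ∧
        (∀ (w : UnitaryGroup.PlacesOver L v) (i j : Fin 2),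
          ValuativeRel.valuation (w.1.adicCompletion L) (algebraMap L (w.1.adicCompletion L) (algebraMap (Fp L) L (Dinv i j))) ≤ 1) := by
  obtain ⟨D, Dinv, Q, hDD, hDD', hQm, hQ⟩ :=
    exists_adaptedFrame (Fp L) 2 (gramR_isSymm L e dV hdV dW hdW) (isUnit_det_gramR₀ L e dV hdV hdV0 dW hdW hdW0)
  exact ⟨D, Dinv, Q, hDD, hDD', hQm, hQ, exists_finset_forall_placeLetters_cm L e dV hdV dW hdW hdV0 hdW0 χ D Dinv⟩

variable [∀ v : HeightOneSpectrum (𝓞 (Fp L)), MeasurableSpace ↥(unipDeltaLoc L e dV hdV dW hdW v)]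
  [∀ v : HeightOneSpectrum (𝓞 (Fp L)), BorelSpace ↥(unipDeltaLoc L e dV hdV dW hdW v)]

/-- **(F-GK-4) ED. 3 — THE (E4) FACE AT THE RECORD IS THE GINDIKIN–KARPELEVICH SCALAR `c_v(s)` OFF A FINITE SET OF PLACES (unconditional).**  For the doubled CM
datum `H = U(𝕎 ⊕ −𝕎)`, `𝕎 = V ⊗ W` of rank `2` with non-degenerate diagonal Gram data (`hdV0`, `hdW0`), `lam : C_L → S¹` conjugate-symplectic and
`χ = toHeckeCharacter L lam⁻¹`: there is a finite set `T₀` of finite places of `L⁺` such that for every `v ∉ T₀`, every Haar measure `ν` on `N_Δ(L⁺_v) = unipDeltaLoc v`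
with ★ (E3)'s normalisation `ν(K_{H,v} ∩ N_Δ(L⁺_v)) = 1`, and every `1 < re s`,
**`∫ y, Λ_{s,v}((w_Δ)_v · y) dν(y) = [(1 − q_v^{−(2s+1)})(1 − ε(ϖ_v) q_v^{−(2s+2)})] ∕ [(1 − q_v^{−2s})(1 − ε(ϖ_v) q_v^{−(2s−1)})]`** (`ε = ε_{L∕L⁺}`, `q_v = N v`) — the pointwise letter
`hI` of ★ `K2LiuBigCellTailScalar.invScalar_mul_tprod_eq_finsetProd_cm` for ★ (E3) `exists_eulerHead_intertwiningDelta`'s tail.  Proof: §3 `…_of_record` with its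
cofinite D10 letter `hGK` paid by ★ (F-GK-3) FILE B `localIntertwining_one_eq_aNorm_of_isSphericalSection_of_isGoodPlace` in the ONE frame of
`exists_frame_finset_forall_placeLetters_cm`, `hχu` by ★ `norm_localComponent_of_record`.
[cite: Liu2011, §2C (2-4) p. 863] [cite: Casselman1980, §3 Thm. 3.1] [cite: HarrisKudlaSweet1996, §6 (6.14)–(6.16)] [cite: Harris2007, (1.3.4) p. 92] [cite: GelbartRogawski1991, §3.1 (3.1.3)] -/
theorem exists_finset_forall_integral_lambdaLoc_weylDelta_eq_localScalar (hdV0 : ∀ i, dV i ≠ 0) (hdW0 : ∀ i, dW i ≠ 0)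
    {lam : IdeleClassGroup L →ₜ* Circle} (hlam : IsConjugateSymplectic L lam) :
    ∃ T₀ : Finset (HeightOneSpectrum (𝓞 (Fp L))), ∀ v ∉ T₀,
      ∀ (ν : Measure ↥(unipDeltaLoc L e dV hdV dW hdW v)) [ν.IsHaarMeasure],
        ν (((inH (fun v => UnitaryGroup.localInt L (IsCMField.complexConj L) (2 + 2) (hermD L e dV hdV dW hdW) v) (fun v => unipDeltaLoc L e dV hdV dW hdW v) v) :
          Subgroup ↥(unipDeltaLoc L e dV hdV dW hdW v)) : Set ↥(unipDeltaLoc L e dV hdV dW hdW v)) = 1 →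
        ∀ s : ℂ, 1 < s.re →
          ∫ y, LambdaLoc L e dV hdV dW hdW v (toHeckeCharacter L lam⁻¹) s (UnitaryGroup.evalPlace (Fp L) L (IsCMField.complexConj L) (2 + 2) (hermD L e dV hdV dW hdW) v (UnitaryGroup.finPart (Fp L) L (IsCMField.complexConj L) (2 + 2) (hermD L e dV hdV dW hdW) (SiegelDoubled.weylDelta L e dV hdV dW hdW)) * (y : UnitaryGroup.localPi L (IsCMField.complexConj L) (2 + 2) (hermD L e dV hdV dW hdW) v)) ∂ν =
            ((1 - (v.residueCard : ℂ) ^ (-(2 * s + 1))) * (1 - (quadraticHeckeCharCM L).valueAtUniformizer v * (v.residueCard : ℂ) ^ (-(2 * s + 2)))) /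
              ((1 - (v.residueCard : ℂ) ^ (-(2 * s))) * (1 - (quadraticHeckeCharCM L).valueAtUniformizer v * (v.residueCard : ℂ) ^ (-(2 * s - 1)))) := by
  obtain ⟨D, Dinv, Q, hDD, hDD', hQm, hQ, T₁, hT₁⟩ := exists_frame_finset_forall_placeLetters_cm L e dV hdV dW hdW hdV0 hdW0 (toHeckeCharacter L lam⁻¹)
  refine exists_finset_forall_integral_lambdaLoc_weylDelta_eq_localScalar_of_record L e dV hdV dW hdW hlam T₁ fun v hv s hs => ?_
  obtain ⟨hgood, hDw, hDiw⟩ := hT₁ v hv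
  haveI : Algebra.IsQuadraticExtension (Fp L) L := IsCMField.isQuadraticExtension L
  intro _ _ νN _ f hf
  exact localIntertwining_one_eq_aNorm_of_isSphericalSection_of_isGoodPlace (Fp L) L (IsCMField.complexConj L) (complexConj_imagUnit L) (imagUnit_ne_zero L)
    (imagUnit_mul_self L) v (gramR_isSymm L e dV hdV dW hdW) (hermD_eq_map_gramD L e dV hdV dW hdW) D Dinv hDD hDD' Q hQm hQ hDw hDiw νN
    (fun w : UnitaryGroup.PlacesOver L v => (toHeckeCharacter L lam⁻¹).localComponent w.1) (norm_localComponent_of_record L lam v) hgood hs hf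

end Unconditional

end Summit.HodgeConjecture.HodgeConjecture.Cruxes.HLiu418.K2LiuSphericalSiegelValueCM

end
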